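import Summits.QuantumFields.YangMills.Theorems.UnitScaleTiltFluctuationComparisonRegPrGlobalSlackKernelLegGeometry
import Summits.QuantumFields.YangMills.Theorems.UnitScaleTiltFluctuationComparisonRegPrGlobalSlackKernelLegSummableT
import Summits.QuantumFields.YangMills.Theorems.UnitScaleTiltFluctuationComparisonRegPrGlobalSlackCanonicalPolymersCover
import Summits.QuantumFields.Balaban3D.Proofs.TorusLift
import HarnessLib

/-!
# `UnitScaleTiltFluctuationComparisonRegPrGlobalSlackKernelLegGeometrySum` — THE LEG SUMMABILITY OF THE CANONICAL LEG DISTANCE, DISCHARGED; STUB 3⁗ FROM THE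
# ANALYTIC LEG ROWS ALONE (crux `FluctuationComparisonRegPrIntL`, stmt-QuantumFields-20520, STUB 3⁗ `stub_globalTwoRunSlackFam`; width-lever lane A; W-slack-2 follow-up)

Seat ym-ust-19935-slack g2 (prover).  With the concrete leg distance `canonLegDist F` of `…KernelLegGeometry` (least periodic ℓ¹ distance to the anchor set = the
level-`b` shadow of the domain) the third geometry row of the leg-currency line, `LegSummableT` (`Σ_c e^{−κ₂d(c)} ≤ S·(1 + 𝓛(Y))` on the listed domains), is a
THEOREM for the canonical polymerisation of every v3 family — (45) p.267 «summation over all Y_j with y fixed» as lattice combinatorics: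

* §1 the bond sum is three site sums; the leg decay from the anchor SET is bounded by the sum over anchors of the leg decay from each anchor
  (`exp_neg_canonLegDist_le_sum`); hence `Σ_c e^{−a·d(c)} ≤ 3·K₁(3,a)·#anchors` (`sum_exp_canonLegDist_le`, torus sum `sum_exp_pdist_le` uniform in the period);
* §2 anchor counts: a label fibre `{z | ⌊z_ν/M⌋ = v_ν ∀ν}` has `≤ M³` sites (`card_filter_label_le`, residues mod `M`); the shadow of a BLOCK has `≤ L³` sites, the
  shadow of a step-`b` DOMAIN `X` has `≤ M₁³·#X.1 ≤ 32M₁³(1 + dj X)` sites (LQB (2.30) lower half `card_le_torusTreeLen`, and `dj X = canonTreeLen` by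
  `canonTreeLen_domSet`); so on every listed domain `#anchors ≤ max(L³, 32M₁³)·(1 + 𝓛(Y))` (`card_anchors_canon_le`);
* §3 **`legSummableT_canon : LegSummableT (dataOfV3 p (canonPolymer p)) (canonLegDist F) a (3·K₁(3,a)·max(L³, 32M₁³))`** for every `a > 0` and every family `p`;
* §4 **`K1aLegRowsG L 𝔠 a₀ a₁ a`** — the K1a line in leg currency with the leg distance PINNED to `canonLegDist F` and ALL THREE GEOMETRY ROWS REMOVED (they are
  theorems): per family a coherent `p` and ONE chart family with `TaylorSplitΦ (canonPT p)`, K1a `FlatKernelLegCauchyΦ`, (43) `KernelLegPointwiseΦ`,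
  `RemainderSmallΦ`, (44) `CfgDistΦ`, `CfgDistCauchyΦ` — nothing else; **`k1aLegRowsT_of_G`**, **`globalTwoRunSlackFam_of_k1aLegRowsG : (∀ L …, ∃ a, 0 < a ∧
  a < 1 ∧ K1aLegRowsG L 𝔠 a₀ a₁ a) → ⟨THE REGISTERED TEXT OF stub_globalTwoRunSlackFam⟩`**.
Every `def … : Prop` is a hypothesis schema (never asserted); the rest is lattice combinatorics; nothing of [Balaban1985UV3]/[King1986] is asserted.

References: T. Bałaban, CMP 102 (1985) 255–275 [Balaban1985UV3] ((24) p.262, (43)–(46) pp.266–267, (59) p.270); CMP 116 (1988) 1–22 [Balaban1988RG2Cluster]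
((2.30) p.18); CMP 109 (1987) 249–301 [Balaban1987RG1] ((0.1)–(0.3) pp.251–252, (5.10) p.293); C. King, CMP 102 (1986) 649–677 [King1986] (Thm 3.4 (3.9) p.656).
-/

set_option autoImplicit false

noncomputable section

open scoped BigOperators
open Finset
open Literature.MathematicalPhysics.QuantumFieldTheory.Balaban1983to89
open Literature.MathematicalPhysics.QuantumFieldTheory.Balaban1983to89.T3ContinuumYM3Torus
open Literature.MathematicalPhysics.QuantumFieldTheory.Balaban1983to89.T3UnitScaleTilt
open Literature.MathematicalPhysics.QuantumFieldTheory.Balaban1983to89.T3LevelShift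
open Literature.MathematicalPhysics.QuantumFieldTheory.Balaban1983to89.T3AlphaInputsAC
open Literature.MathematicalPhysics.QuantumFieldTheory.Balaban1983to89.T3AlphaPolymerSocket
open Literature.MathematicalPhysics.QuantumFieldTheory.Balaban1983to89.T3AlphaInputsACTwoRun
open Literature.MathematicalPhysics.QuantumFieldTheory.Balaban1983to89.T3AlphaInputsACTwoRunLevel
open Literature.MathematicalPhysics.QuantumFieldTheory.Balaban1983to89.TreeLengthTorus (tsys TPt card_le_torusTreeLen)
open Literature.MathematicalPhysics.QuantumFieldTheory.Balaban1983to89.B12Decay510Window (K₁ K₁_nonneg)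
open Literature.MathematicalPhysics.QuantumFieldTheory.Balaban1985CMP102
open Literature.MathematicalPhysics.QuantumFieldTheory.Balaban1985CMP102.Setting
open Summit.QuantumFields.Balaban3D.Carriers
open Summit.QuantumFields.Balaban3D.Proofs.Primitives
open Summit.QuantumFields.Balaban3D.Proofs.GroupModelLieC (lieC)
open Summit.QuantumFields.Balaban3D.Proofs.TorusLift (val_coarsen)
open Summit.QuantumFields.YangMills.Theorems
open Summit.QuantumFields.YangMills.Theorems.GlobalSlackKernelMatching
open Summit.QuantumFields.YangMills.Theorems.GlobalSlackCanonicalPolymers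

namespace Summit.QuantumFields.YangMills.Theorems.GlobalSlackKernelLeg

variable {F : T3Family}

/-! ## §1 The bond sum of the leg decay is controlled by the anchor count -/

/-- A sum over positively oriented bonds of a function of the source is three times the site sum. [cite: Balaban1985Averaging, (5) p.18] -/
theorem sum_pbond_src {K b : ℕ} (g : Site (F.P K) b → ℝ) : ∑ c : PBond (F.P K) b, g c.src = 3 * ∑ x : Site (F.P K) b, g x := by
  classical
  let e : Site (F.P K) b × Fin 3 ≃ PBond (F.P K) b := ⟨fun p => ⟨p.1, p.2⟩, fun c => (c.src, c.dir), fun _ => rfl, fun _ => rfl⟩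
  rw [← Fintype.sum_equiv e (fun p => g p.1) (fun c => g c.src) (fun _ => rfl), Fintype.sum_prod_type]
  simp only [Finset.sum_const, Finset.card_univ, Fintype.card_fin, nsmul_eq_mul, Nat.cast_ofNat]
  rw [Finset.mul_sum]

/-- The leg decay from the anchor SET is at most the sum over the anchors of the leg decay from each anchor. [cite: Balaban1985UV3, (45) p.267] -/
theorem exp_neg_canonLegDist_le_sum (K b : ℕ) (Y : Set (Site (F.P K) 0)) (c : PBond (F.P K) b) (a : ℝ) :
    Real.exp (-(a * canonLegDist F K b Y c)) ≤ ∑ z ∈ anchors K b Y, Real.exp (-(a * pdist c.src z)) := by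
  obtain ⟨z, hz, heq⟩ := exists_canonLegDist_eq K b Y c
  rw [heq]
  exact Finset.single_le_sum (f := fun z => Real.exp (-(a * pdist c.src z))) (fun _ _ => (Real.exp_pos _).le) hz

/-- **THE BOND SUM OF THE LEG DECAY**: `Σ_c e^{−a·d(c)} ≤ 3·K₁(3,a)·#anchors` (`a > 0`). [cite: Balaban1985UV3, (45) p.267] -/
theorem sum_exp_canonLegDist_le (K b : ℕ) (Y : Set (Site (F.P K) 0)) {a : ℝ} (ha : 0 < a) :
    ∑ c : PBond (F.P K) b, Real.exp (-(a * canonLegDist F K b Y c)) ≤ 3 * K₁ 3 a * (anchors K b Y).card := by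
  calc ∑ c : PBond (F.P K) b, Real.exp (-(a * canonLegDist F K b Y c))
      ≤ ∑ c : PBond (F.P K) b, ∑ z ∈ anchors K b Y, Real.exp (-(a * pdist c.src z)) :=
        Finset.sum_le_sum fun c _ => exp_neg_canonLegDist_le_sum K b Y c a
    _ = 3 * ∑ x : Site (F.P K) b, ∑ z ∈ anchors K b Y, Real.exp (-(a * pdist x z)) :=
        sum_pbond_src (fun x => ∑ z ∈ anchors K b Y, Real.exp (-(a * pdist x z)))
    _ = 3 * ∑ z ∈ anchors K b Y, ∑ x : Site (F.P K) b, Real.exp (-(a * pdist x z)) := by rw [Finset.sum_comm]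
    _ ≤ 3 * ∑ _z ∈ anchors K b Y, K₁ 3 a := by
        refine mul_le_mul_of_nonneg_left (Finset.sum_le_sum fun z _ => sum_exp_pdist_le z ha) (by norm_num)
    _ = 3 * K₁ 3 a * (anchors K b Y).card := by rw [Finset.sum_const, nsmul_eq_mul]; ring

/-! ## §2 Anchor counts on the listed domains -/

/-- **A LABEL FIBRE HAS AT MOST `M³` SITES**: the level-`b` sites whose coordinates have prescribed integer quotients by `M` (`M > 0`) are determined by their
residues mod `M`. [cite: Balaban1985UV3, (24) p.262] -/
theorem card_filter_label_le (K b : ℕ) {M : ℕ} (hM : 0 < M) (v : Fin 3 → ℕ) :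
    (Finset.univ.filter fun z : Site (F.P K) b => ∀ ν : Fin 3, (z ν).val / M = v ν).card ≤ M ^ 3 := by
  classical
  let f : Site (F.P K) b → (Fin 3 → Fin M) := fun z ν => ⟨(z ν).val % M, Nat.mod_lt _ hM⟩
  have hcard : (Finset.univ : Finset (Fin 3 → Fin M)).card = M ^ 3 := by
    rw [Finset.card_univ, Fintype.card_fun, Fintype.card_fin, Fintype.card_fin]
  rw [← hcard]
  refine Finset.card_le_card_of_injOn f (fun _ _ => Finset.mem_coe.mpr (Finset.mem_univ _)) ?_
  intro z hz z' hz' hzz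
  rw [Finset.mem_coe, Finset.mem_filter] at hz hz'
  funext ν
  apply ZMod.val_injective
  have h1 : (z ν).val = M * v ν + (z ν).val % M := by rw [← hz.2 ν]; exact (Nat.div_add_mod _ _).symm
  have h2 : (z' ν).val = M * v ν + (z' ν).val % M := by rw [← hz'.2 ν]; exact (Nat.div_add_mod _ _).symm
  have h3 : (z ν).val % M = (z' ν).val % M := by
    have := congrFun hzz ν
    exact congrArg Fin.val this
  rw [h1, h2, h3]

variable {𝔠 : AlphaConsts F.L (suGroupModel 2).N} {γ : ℝ} {hγ : 0 < γ} {hγ1 : γ ≤ (min 𝔠.gamma0 1) ^ 2}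

/-- **THE SHADOW OF A BLOCK HAS AT MOST `L³` SITES**: the level-`b` sites under a level-`(b+1)` site (`b + 1 ≤ m + K`). [cite: Balaban1987RG1, (0.3) p.252] -/
theorem card_shadow_blockSet_le (K b i : ℕ) (hib : i = b + 1) (hb : i ≤ F.m + K) (y : Site (F.P K) i) :
    (shadow K b (blockSet K i y)).card ≤ F.L ^ 3 := by
  classical
  subst hib
  have hL : 0 < F.L := by have := F.hL.2; omega
  refine le_trans (Finset.card_le_card ?_) (card_filter_label_le K b hL fun ν => (y ν).val)
  intro z hz
  obtain ⟨x, hx, rfl⟩ := mem_shadow.mp hz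
  rw [Finset.mem_filter]
  refine ⟨Finset.mem_univ _, fun ν => ?_⟩
  have hxy : coarsen (b + 1) x = y := hx
  rw [val_coarsen (P := F.P K) b (show b ≤ (F.P K).m + (F.P K).K by exact Nat.le_of_succ_le hb) x ν, ← hxy,
    val_coarsen (P := F.P K) (b + 1) (show b + 1 ≤ (F.P K).m + (F.P K).K from hb) x ν, Nat.div_div_eq_div_mul, pow_succ]
  rfl

/-- **THE SHADOW OF A STEP-`b` DOMAIN HAS AT MOST `M₁³·#X.1` SITES**. [cite: Balaban1985UV3, (24) p.262, (59) p.270] -/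
theorem card_shadow_domSet_le (K b : ℕ) (X : (tsys 3 (nblkOf (SK F 𝔠 γ hγ hγ1 K) 𝔠.lane.carrier b)).Dom) :
    ((shadow K b (domSet (F := F) 𝔠.lane.carrier.M₁ K b X)).card : ℝ) ≤ (𝔠.M₁ : ℝ) ^ 3 * X.1.card := by
  classical
  have hM : 0 < 𝔠.M₁ := 𝔠.M₁_pos
  have hsub : shadow K b (domSet (F := F) 𝔠.lane.carrier.M₁ K b X) ⊆
      X.1.biUnion fun β => Finset.univ.filter fun z : Site (F.P K) b => ∀ ν : Fin 3, (z ν).val / 𝔠.M₁ = (β ν).val := by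
    intro z hz
    obtain ⟨x, hx, rfl⟩ := mem_shadow.mp hz
    obtain ⟨β, hβ, hlab⟩ := hx
    rw [Finset.mem_biUnion]
    refine ⟨β, hβ, Finset.mem_filter.mpr ⟨Finset.mem_univ _, fun ν => ?_⟩⟩
    exact congrFun hlab ν
  have hcard := (Finset.card_le_card hsub).trans (Finset.card_biUnion_le.trans (Finset.sum_le_sum fun β _ => card_filter_label_le K b hM fun ν => (β ν).val))
  rw [Finset.sum_const, smul_eq_mul] at hcard
  calc ((shadow K b (domSet (F := F) 𝔠.lane.carrier.M₁ K b X)).card : ℝ) ≤ ((X.1.card * 𝔠.M₁ ^ 3 : ℕ) : ℝ) := by exact_mod_cast hcard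
    _ = (𝔠.M₁ : ℝ) ^ 3 * X.1.card := by push_cast; ring

/-- A step-`b` domain has at most `32·(1 + dj X)` cubes (LQB's lower half of (2.30) in `d = 3`: `#X ≤ 8(4·d(X) + 1)`). [cite: Balaban1988RG2Cluster, (2.30) p.18] -/
theorem card_dom_le_treeLen {N : ℕ} [NeZero N] (X : (tsys 3 N).Dom) : (X.1.card : ℝ) ≤ 32 * (1 + (tsys 3 N).dj X) := by
  have h := card_le_torusTreeLen X.2.1 X.2.2
  have h0 := (tsys 3 N).dj_nonneg X
  have hdj : (tsys 3 N).dj X = TreeLengthTorus.torusTreeLen X.1 := rfl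
  rw [hdj] at h0 ⊢
  norm_num at h
  linarith

/-- **THE ANCHOR COUNT ON THE LISTED DOMAINS**: for every `Y ∈ Loc K j h i` of the canonical polymerisation (term level `i = 1+b`),
`#anchors K b Y ≤ max(L³, 32M₁³)·(1 + 𝓛(Y))`. [cite: Balaban1985UV3, (24) p.262, (45) p.267, (59) p.270] -/
theorem card_anchors_canon_le (p : ∀ K, AlphaInputsT3AC.PkgAtV3 F 𝔠 γ hγ hγ1 K) (K j : ℕ) (h : Hist (F.P K) j) (b : ℕ) (Y : Set (Site (F.P K) 0))
    (hY : Y ∈ canonLoc p K j h (1 + b)) :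
    ((anchors K b Y).card : ℝ) ≤ max ((F.L : ℝ) ^ 3) (32 * (𝔠.M₁ : ℝ) ^ 3) * (1 + canonTreeLen p K (1 + b) Y) := by
  classical
  have hT0 : 0 ≤ canonTreeLen p K (1 + b) Y := canonTreeLen_nonneg p K (1 + b) Y
  have hmax1 : (1 : ℝ) ≤ max ((F.L : ℝ) ^ 3) (32 * (𝔠.M₁ : ℝ) ^ 3) := by
    have hL1 : (1 : ℝ) ≤ F.L := by exact_mod_cast F.hL.2.le
    exact le_max_of_le_left (one_le_pow₀ hL1)
  have hmax0 : (0 : ℝ) ≤ max ((F.L : ℝ) ^ 3) (32 * (𝔠.M₁ : ℝ) ^ 3) := zero_le_one.trans hmax1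
  by_cases hspec : Y = Set.univ ∨ shadow K b Y = ∅ ∨ F.m + K < b
  · -- single anchor (the origin)
    have hA : anchors K b Y = {default} := by unfold anchors; rw [if_pos hspec]
    rw [hA, Finset.card_singleton, Nat.cast_one]
    nlinarith
  · -- the shadow of a listed block or domain
    have hA : anchors K b Y = shadow K b Y := by unfold anchors; rw [if_neg hspec]
    have hYne : Y ≠ Set.univ := fun hu => hspec (Or.inl hu)
    rw [hA]
    cases j with
    | zero => simp [canonLoc] at hY
    | succ k =>
      by_cases hk : k + 1 ≤ K
      · by_cases hik : 1 + b = k + 1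
        · -- NEW-term domain at step `b = k`
          have hbk : k = b := by omega
          subst hbk
          simp only [canonLoc, if_pos hk, if_pos hik, mem_image] at hY
          obtain ⟨X, -, rfl⟩ := hY
          have hbm : k ≤ F.m + K := by have := F.hm; omega
          have h1 := card_shadow_domSet_le (γ := γ) (hγ := hγ) (hγ1 := hγ1) K k X
          have h2 := card_dom_le_treeLen X
          have hdj0 := (tsys 3 (nblkOf (SK F 𝔠 γ hγ hγ1 K) 𝔠.lane.carrier k)).dj_nonneg X
          rw [show 1 + k = k + 1 by ring, canonTreeLen_domSet p K k hbm X]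
          have hM3 : (0 : ℝ) ≤ (𝔠.M₁ : ℝ) ^ 3 := by positivity
          calc ((shadow K k (domSet (F := F) 𝔠.lane.carrier.M₁ K k X)).card : ℝ) ≤ (𝔠.M₁ : ℝ) ^ 3 * X.1.card := h1
            _ ≤ (𝔠.M₁ : ℝ) ^ 3 * (32 * (1 + (tsys 3 _).dj X)) := mul_le_mul_of_nonneg_left h2 hM3
            _ = (32 * (𝔠.M₁ : ℝ) ^ 3) * (1 + (tsys 3 _).dj X) := by ring
            _ ≤ max ((F.L : ℝ) ^ 3) (32 * (𝔠.M₁ : ℝ) ^ 3) * (1 + (tsys 3 _).dj X) := mul_le_mul_of_nonneg_right (le_max_right _ _) (by linarith)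
        · by_cases hi : 1 + b ∈ Finset.Icc 1 k
          · -- OLD-term block at level `1 + b`
            simp only [canonLoc, if_pos hk, if_neg hik, if_pos hi, mem_image] at hY
            obtain ⟨y, -, rfl⟩ := hY
            have hbm : 1 + b ≤ F.m + K := by have := (Finset.mem_Icc.mp hi).2; have := F.hm; omega
            have h1 := card_shadow_blockSet_le K b (1 + b) (by ring) hbm y
            calc ((shadow K b (blockSet K (1 + b) y)).card : ℝ) ≤ ((F.L ^ 3 : ℕ) : ℝ) := by exact_mod_cast h1
              _ = (F.L : ℝ) ^ 3 := by push_cast; ring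
              _ ≤ max ((F.L : ℝ) ^ 3) (32 * (𝔠.M₁ : ℝ) ^ 3) * 1 := by rw [mul_one]; exact le_max_left _ _
              _ ≤ max ((F.L : ℝ) ^ 3) (32 * (𝔠.M₁ : ℝ) ^ 3) * (1 + canonTreeLen p K (1 + b) (blockSet K (1 + b) y)) :=
                  mul_le_mul_of_nonneg_left (by linarith [canonTreeLen_nonneg p K (1 + b) (blockSet K (1 + b) y)]) hmax0
          · simp only [canonLoc, if_pos hk, if_neg hik, if_neg hi] at hY
            simp at hY
      · by_cases hi1 : 1 + b = 1
        · -- the dummy whole-torus domain has the origin as anchor set: excluded by `hYne`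
          simp only [canonLoc, if_neg hk, if_pos hi1, mem_singleton] at hY
          exact absurd hY hYne
        · simp only [canonLoc, if_neg hk, if_neg hi1] at hY
          simp at hY

/-! ## §3 The leg summability of the canonical leg distance — a theorem for every v3 family -/

/-- The summability constant of the canonical leg distance (before the family: a function of `L`, the record and the decay rate). [cite: Balaban1985UV3, (45) p.267] -/
def legSumConst (L : ℕ) (𝔠 : AlphaConsts L (suGroupModel 2).N) (a : ℝ) : ℝ :=
  3 * K₁ 3 a * max ((L : ℝ) ^ 3) (32 * (𝔠.M₁ : ℝ) ^ 3)

/-- `0 ≤ legSumConst`. [folklore] -/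
theorem legSumConst_nonneg (L : ℕ) (𝔠 : AlphaConsts L (suGroupModel 2).N) (a : ℝ) : 0 ≤ legSumConst L 𝔠 a := by
  unfold legSumConst
  have := K₁_nonneg 3 a
  have : (0 : ℝ) ≤ max ((L : ℝ) ^ 3) (32 * (𝔠.M₁ : ℝ) ^ 3) := le_max_of_le_left (by positivity)
  positivity

/-- **`LegSummableT` FOR THE CANONICAL LEG DISTANCE ON THE CANONICAL POLYMERISATION — DISCHARGED**: for every `a > 0` and every v3 family `p`,
`Σ_c e^{−a·d(c)} ≤ legSumConst·(1 + 𝓛(Y))` on every listed domain. [cite: Balaban1985UV3, (45) p.267] -/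
theorem legSummableT_canon (p : ∀ K, AlphaInputsT3AC.PkgAtV3 F 𝔠 γ hγ hγ1 K) {a : ℝ} (ha : 0 < a) :
    LegSummableT (AlphaInputsT3AC.dataOfV3 p (canonPolymer p)) (canonLegDist F) a (legSumConst F.L 𝔠 a) := by
  intro K k b Y hY
  have hK : 0 ≤ 3 * K₁ 3 a := by have := K₁_nonneg 3 a; positivity
  refine (sum_exp_canonLegDist_le K b Y ha).trans ?_
  have hc := card_anchors_canon_le p K k (Hist.triv (F.P K) k) b Y hY
  calc 3 * K₁ 3 a * ((anchors K b Y).card : ℝ) ≤ 3 * K₁ 3 a * (max ((F.L : ℝ) ^ 3) (32 * (𝔠.M₁ : ℝ) ^ 3) * (1 + canonTreeLen p K (1 + b) Y)) :=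
        mul_le_mul_of_nonneg_left hc hK
    _ = legSumConst F.L 𝔠 a * (1 + canonTreeLen p K (1 + b) Y) := by unfold legSumConst; ring

/-- `LegSummableT` is monotone in the constant. [folklore] -/
theorem legSummableT_mono_S {γ' : ℝ} {D : AlphaDataT3 F γ'} {dist : LegDist F} {κ₂ S S' : ℝ} (hT : ∀ K i Y, 0 ≤ D.treeLen K i Y) (hS : S ≤ S')
    (h : LegSummableT D dist κ₂ S) : LegSummableT D dist κ₂ S' :=
  fun K k b Y hY => (h K k b Y hY).trans (mul_le_mul_of_nonneg_right hS (by linarith [hT K (1 + b) Y]))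

/-! ## §4 The K1a line in leg currency with the geometry discharged, and the registered stub -/

/-- **THE K1a LEG ROWS AT THE CANONICAL LEG DISTANCE — GEOMETRY DISCHARGED** (hypothesis schema, never asserted): rates `0 < κ′ < κ₁`, nonnegative constants, a
threshold, and for every family / coupling / inhabited v3 package a coherent `p` with the given [7]-constants and ONE chart family with configurations / vacuum
constants / rests carrying EXACTLY the six analytic rows at the canonical leg distance `canonLegDist F`: `TaylorSplitΦ (canonPT p)`, K1a `FlatKernelLegCauchyΦ`
(weights `κ′`), (43) `KernelLegPointwiseΦ` (per-leg decay `κ₁`, `g`-free), `RemainderSmallΦ`, (44) `CfgDistΦ`, `CfgDistCauchyΦ` — decay `𝔠.κ`, profile `p₀`; NO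
geometry row, NO letter on the record. [cite: Balaban1985UV3, (43)-(46) pp.266-267, (57) p.270; King1986, Prop. 3.6 (3.56) p.662, Prop. 3.9 (3.71)-(3.74) p.665] -/
def K1aLegRowsG (L : ℕ) (𝔠 : AlphaConsts L (suGroupModel 2).N) (a₀ a₁ a : ℝ) : Prop :=
  ∃ (κ' κ₁ C A C_R C_s C_B γB : ℝ), 0 < κ' ∧ κ' < κ₁ ∧ 0 ≤ C ∧ 0 ≤ A ∧ 0 ≤ C_R ∧ 0 ≤ C_s ∧ 0 ≤ C_B ∧ 0 < γB ∧
    ∀ (F : T3Family) (γ : ℝ) (hF : F.L = L) (hγ : 0 < γ), γ ≤ γB → ∀ (hγ1 : γ ≤ (min (hF ▸ 𝔠).gamma0 1) ^ 2),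
      AlphaInputsT3AC.OfV3At F (hF ▸ 𝔠) a₀ a₁ →
        ∃ (p : ∀ K, AlphaInputsT3AC.PkgAtV3 F (hF ▸ 𝔠) γ hγ hγ1 K), (∀ K, (p K).a₀ = a₀ ∧ (p K).a₁ = a₁) ∧
          ∃ (Φ : ChartFam ↥(lieC (suGroupModel 2)) F) (e : VacFam F) (B : CfgFam ↥(lieC (suGroupModel 2)) F) (R : RemFam F),
            TaylorSplitΦ (canonPT p) Φ e B R ∧
            FlatKernelLegCauchyΦ (AlphaInputsT3AC.dataOfV3 p (canonPolymer p)) Φ (canonLegDist F) κ' (hF ▸ 𝔠).κ a C ∧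
            KernelLegPointwiseΦ (AlphaInputsT3AC.dataOfV3 p (canonPolymer p)) Φ (canonLegDist F) κ₁ (hF ▸ 𝔠).κ A ∧
            RemainderSmallΦ (AlphaInputsT3AC.dataOfV3 p (canonPolymer p)) R (hF ▸ 𝔠).b₀ (hF ▸ 𝔠).p₀ (hF ▸ 𝔠).κ C_R ∧
            CfgDistΦ (AlphaInputsT3AC.dataOfV3 p (canonPolymer p)) B (canonLegDist F) (hF ▸ 𝔠).b₀ (hF ▸ 𝔠).p₀ C_s ∧
            CfgDistCauchyΦ (AlphaInputsT3AC.dataOfV3 p (canonPolymer p)) B (canonLegDist F) (hF ▸ 𝔠).b₀ (hF ▸ 𝔠).p₀ a C_B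

/-- **THE GEOMETRY IS DISCHARGED**: `K1aLegRowsG → K1aLegRowsT` with `dist := canonLegDist F`, `S := max 1 (legSumConst L 𝔠 (κ₁ − κ′))` (`canonLegDist_nonneg`,
`canonLegDist_matched`, `legSummableT_canon`). [cite: Balaban1985UV3, (45) p.267; Balaban1987RG1, (0.1) p.251] -/
theorem k1aLegRowsT_of_G {L : ℕ} {𝔠 : AlphaConsts L (suGroupModel 2).N} {a₀ a₁ a : ℝ} (h : K1aLegRowsG L 𝔠 a₀ a₁ a) : K1aLegRowsT L 𝔠 a₀ a₁ a := by
  obtain ⟨κ', κ₁, C, A, C_R, C_s, C_B, γB, hκ', hκ1, hC, hA, hCR, hCs, hCB, hγB, hall⟩ := h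
  refine ⟨κ', κ₁, max 1 (legSumConst L 𝔠 (κ₁ - κ')), C, A, C_R, C_s, C_B, γB, hκ', hκ1, le_max_left _ _, hC, hA, hCR, hCs, hCB, hγB,
    fun F γ hF hγ hγle hγ1 hOf => ?_⟩
  subst hF
  obtain ⟨p, hp, Φ, e, B, R, hT, hK, hP, hR, hS, hBC⟩ := hall F γ rfl hγ hγle hγ1 hOf
  have hTl : ∀ K i Y, 0 ≤ (AlphaInputsT3AC.dataOfV3 p (canonPolymer p)).treeLen K i Y := fun K i Y => canonTreeLen_nonneg p K i Y
  exact ⟨p, hp, canonLegDist F, Φ, e, B, R, canonLegDist_nonneg F, canonLegDist_matched F,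
    legSummableT_mono_S hTl (le_max_right _ _) (legSummableT_canon p (by linarith)), hT, hK, hP, hR, hS, hBC⟩

/-- **THE REGISTERED STUB 3⁗ FROM THE SIX ANALYTIC LEG ROWS ALONE, BY NAME** (`globalTwoRunSlackFam_of_k1aLegRowsT ∘ k1aLegRowsT_of_G`): if for every odd `L ≥ 7`,
every constants record and [7]-constants there is a rate exponent `0 < a < 1` with `K1aLegRowsG L 𝔠 a₀ a₁ a`, then the text of `stub_globalTwoRunSlackFam` (skeleton v5k
`Cruxes/FluctuationComparisonRegPrIntL/Lines/birth_v5k.lean`) holds VERBATIM. [cite: King1986, Thm 3.4 (3.9) p.656, Prop. 3.6 p.662; Balaban1985UV3, (43)-(46) pp.266-267, (57) p.270] -/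
theorem globalTwoRunSlackFam_of_k1aLegRowsG
    (h : ∀ (L : ℕ), Odd L → 7 ≤ L → ∀ (𝔠 : AlphaConsts L (suGroupModel 2).N) (a₀ a₁ : ℝ), 0 < a₀ → 0 < a₁ → 𝔠.B₃ * a₁ ≤ a₀ →
      ∃ a : ℝ, 0 < a ∧ a < 1 ∧ K1aLegRowsG L 𝔠 a₀ a₁ a) :
    ∀ (L : ℕ), Odd L → 7 ≤ L → ∀ (𝔠 : Summit.QuantumFields.Balaban3D.Proofs.Primitives.AlphaConsts L (Summit.QuantumFields.Balaban3D.Carriers.suGroupModel 2).N)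
      (a₀ a₁ : ℝ), 0 < a₀ → 0 < a₁ → 𝔠.B₃ * a₁ ≤ a₀ →
      ∃ a : ℝ, 0 < a ∧ ∃ γB : ℝ, 0 < γB ∧ ∀ (F : T3Family) (γ : ℝ) (hF : F.L = L) (hγ : 0 < γ), γ ≤ γB →
        ∀ (hγ1 : γ ≤ (min (hF ▸ 𝔠).gamma0 1) ^ 2),
          Summit.QuantumFields.YangMills.Theorems.AlphaInputsT3AC.OfV3At F (hF ▸ 𝔠) a₀ a₁ →
          ∃ (p : ∀ K, Summit.QuantumFields.YangMills.Theorems.AlphaInputsT3AC.PkgAtV3 F (hF ▸ 𝔠) γ hγ hγ1 K),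
            (∀ K, (p K).a₀ = a₀ ∧ (p K).a₁ = a₁) ∧
            ∃ (π : Summit.QuantumFields.YangMills.Theorems.AlphaInputsT3AC.PolymerT3 F) (σ : ℕ) (C : ℝ), 7 ≤ σ ∧ 0 ≤ C ∧
              Summit.QuantumFields.YangMills.Theorems.GlobalSlack.GlobalSupRateTSlack (Summit.QuantumFields.YangMills.Theorems.AlphaInputsT3AC.dataOfV3 p π) (hF ▸ 𝔠).b₀ (hF ▸ 𝔠).p₀ a σ C :=
  globalTwoRunSlackFam_of_k1aLegRowsT fun L hLo h7 𝔠 a₀ a₁ ha0 ha1 hw => by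
    obtain ⟨a, ha, ha1', hc⟩ := h L hLo h7 𝔠 a₀ a₁ ha0 ha1 hw
    exact ⟨a, ha, ha1', k1aLegRowsT_of_G hc⟩

end Summit.QuantumFields.YangMills.Theorems.GlobalSlackKernelLeg

end
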